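import Summits.ResolutionOfSingularities.ResolutionOfSingularities.Theorems.PurelyInseparableDim4JetOrderStaircase
import HarnessLib

/-!
# [OURS · res-dim4-pi] WIDE STATES ARE PLANAR — a ridge of dimension `≤ 2` is separated by a coordinate
  pair, so the plane bound and the order staircase hold PAIR-FREE at every state of an `E2` chain

Cell `res-dim4-pi` (D-0157 DOOR 2), seat `res-dim4-p-3` (g2); glue file after `…JetOrder.lean` (p662591)
and `…JetOrderStaircase.lean` (p663052 / p663270).  Those files work under the hypothesis
`𝔪₀ ≤ (x_a, x_b) + J + 𝔪₀²` for an explicit coordinate pair; the `E2(3,3)` chains of p660329 carry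
instead the frame letter `dim_K A(in F) = 2` (`RidgeBudget.ebar`).  Here: a `K`-subspace of `K⁴` of
dimension `≤ 2` is separated by SOME coordinate pair (`exists_pair_separating_of_finrank_le_two`, pure
linear algebra), hence (with p-1 g2's dual apolarity via `originIdeal_le_span_pair_sup`) every state of
order exactly `q ≥ 2` with `ē ≤ 2` is planar for some pair, and the plane bound
`μ⁺-staircase d_N ≤ N(N+1)/2` and the DOWNWARD STAIRCASE (well-definedness of idea-3's order letter
`o(F) = max {k : d_k = k(k+1)/2}`, CARD I-3-11) hold with NO pair in the statement.

* §1 `linearIndependent_triple_of_apply`, **`exists_pair_separating_of_finrank_le_two`**.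
* §2 `exists_originIdeal_le_span_pair_sup` (ē ≤ 2 ⇒ planar for some pair `a ≠ b`),
  `jetColength_le_triangle_of_finrank_le_two`, **`jetColength_eq_triangle_downward_of_finrank_le_two`**,
  `jetColength_mono`, `triangle_le_jetColength_of_isCert` (the order set is bounded by `μ⁺`).

[OURS · counted 0 · elementary linear algebra; AI kernel work, weaker than expert review.]  Nothing here
is a statement about resolution of singularities; nothing here proves `NoWideTrap` / `E2(3,3)`;
resolution in dimension `≥ 4` / characteristic `p > 0` is NOT proved by anything in this file.  Host item
(DR-157-C): `stmt-ResolutionOfSingularities-16155`, helper.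
-/

noncomputable section

set_option linter.dupNamespace false -- mandated namespace of this single-conjunct summit

open MvPolynomial Finset
open scoped BigOperators

namespace Summit.ResolutionOfSingularities.ResolutionOfSingularities.Theorems.PIDim4.RidgeBudget

open IsolationCert
open Literature.AlgebraicGeometry.Resolution
open Literature.AlgebraicGeometry.Resolution.Hauser2010
open Literature.AlgebraicGeometry.Resolution.HauserPerlega2019
open Literature.Barriers.ResolutionOfSingularities
open PointBlowup (gradSpan additiveSubspace)

variable {K : Type} [Field K]

/-! ## §1 A subspace of `K⁴` of dimension `≤ 2` is separated by a coordinate pair -/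

/-- Three vectors `u, v, w` of a subspace `W ≤ K⁴` with `u_a ≠ 0`, `v_a = w_a = 0`, `v_b ≠ 0`, `w_b = 0`,
`w ≠ 0` are linearly independent (in `W`). OURS (linear algebra). [folklore] -/
theorem linearIndependent_triple_of_apply {W : Submodule K (Fin 4 → K)} {u v w : Fin 4 → K}
    (hu : u ∈ W) (hv : v ∈ W) (hw : w ∈ W) {a b : Fin 4} (hua : u a ≠ 0) (hva : v a = 0)
    (hwa : w a = 0) (hvb : v b ≠ 0) (hwb : w b = 0) (hw0 : w ≠ 0) :
    LinearIndependent K (![⟨u, hu⟩, ⟨v, hv⟩, ⟨w, hw⟩] : Fin 3 → W) := by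
  rw [Fintype.linearIndependent_iff]
  intro g hg
  rw [Fin.sum_univ_three] at hg
  simp only [Matrix.cons_val_zero, Matrix.cons_val_one, Matrix.cons_val_two, Matrix.head_cons,
    Matrix.tail_cons] at hg
  have hg' := congrArg (fun x : W => (x : Fin 4 → K)) hg
  simp only [Submodule.coe_add, Submodule.coe_smul_of_tower, Submodule.coe_zero] at hg'
  have ha := congrFun hg' a
  have hb := congrFun hg' b
  simp only [Pi.add_apply, Pi.smul_apply, smul_eq_mul, Pi.zero_apply, hva, hwa, hwb,
    mul_zero, add_zero] at ha hb
  have h0 : g 0 = 0 := (mul_eq_zero.mp ha).resolve_right hua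
  rw [h0, zero_mul, zero_add] at hb
  have h1 : g 1 = 0 := (mul_eq_zero.mp hb).resolve_right hvb
  have h2 : g 2 = 0 := by
    rw [h0, h1, zero_smul, zero_smul, zero_add, zero_add] at hg'
    exact (smul_eq_zero.mp hg').resolve_right hw0
  intro i
  fin_cases i
  · exact h0
  · exact h1
  · exact h2

/-- **A subspace `W ≤ K⁴` of dimension `≤ 2` is separated by some coordinate pair**: there are
`a ≠ b` with `W ∩ {u_a = u_b = 0} = 0`. OURS (linear algebra: otherwise three independent vectors).
[folklore] -/
theorem exists_pair_separating_of_finrank_le_two {W : Submodule K (Fin 4 → K)}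
    (hW : Module.finrank K W ≤ 2) :
    ∃ a b : Fin 4, a ≠ b ∧ ∀ u ∈ W, u a = 0 → u b = 0 → u = 0 := by
  classical
  by_cases hbot : ∀ u ∈ W, u = 0
  · exact ⟨0, 1, by decide, fun u hu _ _ => hbot u hu⟩
  push Not at hbot
  obtain ⟨u, hu, hu0⟩ := hbot
  obtain ⟨a, hua⟩ : ∃ a, u a ≠ 0 := by
    by_contra h
    push Not at h
    exact hu0 (funext h)
  by_cases hker : ∀ v ∈ W, v a = 0 → v = 0
  · -- the coordinate `a` alone separates `W`
    obtain ⟨b, hab⟩ : ∃ b : Fin 4, a ≠ b := ⟨a + 1, by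
      intro h; have := congrArg Fin.val h; simp [Fin.val_add] at this; omega⟩
    exact ⟨a, b, hab, fun w hw hwa _ => hker w hw hwa⟩
  push Not at hker
  obtain ⟨v, hv, hva, hv0⟩ := hker
  obtain ⟨b, hvb⟩ : ∃ b, v b ≠ 0 := by
    by_contra h
    push Not at h
    exact hv0 (funext h)
  have hab : a ≠ b := fun h => hvb (h ▸ hva)
  refine ⟨a, b, hab, fun w hw hwa hwb => ?_⟩
  by_contra hw0
  have hli := linearIndependent_triple_of_apply hu hv hw hua hva hwa hvb hwb hw0
  have h3 := hli.fintype_card_le_finrank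
  simp only [Fintype.card_fin] at h3
  omega

/-! ## §2 Planarity, plane bound and staircase at `ē ≤ 2`, pair-free -/

/-- **`ē ≤ 2` ⇒ planar for some coordinate pair**: at order exactly `q ≥ 2` with
`dim_K A(in F) ≤ 2` there are `a ≠ b` with `𝔪₀ ≤ (x_a, x_b) + J_q⁺(F) + 𝔪₀²`. OURS (glue:
`exists_pair_separating_of_finrank_le_two` + `originIdeal_le_span_pair_sup`).
[cite: BerthomieuHivertMourtada2010, Cor. 2.3] -/
theorem exists_originIdeal_le_span_pair_sup {q : ℕ} (hq : 2 ≤ q) {F : MvPolynomial (Fin 4) K}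
    (hord : ordZero F = q) (he : Module.finrank K (additiveSubspace (initialForm F)) ≤ 2) :
    ∃ a b : Fin 4, a ≠ b ∧ originIdeal K ≤
      Ideal.span {(X a : MvPolynomial (Fin 4) K), X b} ⊔ singLocusIdeal q F ⊔ originIdeal K ^ 2 := by
  obtain ⟨a, b, hab, h⟩ := exists_pair_separating_of_finrank_le_two he
  exact ⟨a, b, hab, originIdeal_le_span_pair_sup hq hord h⟩

/-- **The plane bound on `E2`-type states, pair-free**: order exactly `q ≥ 2` and `ē ≤ 2` give
`jetColength q N F ≤ N(N+1)/2` at every level. OURS (glue). [cite: AtiyahMacdonald1969, Prop. 6.9 (length is additive)] -/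
theorem jetColength_le_triangle_of_finrank_le_two {q : ℕ} (hq : 2 ≤ q) {F : MvPolynomial (Fin 4) K}
    (hord : ordZero F = q) (he : Module.finrank K (additiveSubspace (initialForm F)) ≤ 2) (N : ℕ) :
    jetColength q N F ≤ N * (N + 1) / 2 := by
  obtain ⟨a, b, -, hm⟩ := exists_originIdeal_le_span_pair_sup hq hord he
  exact jetColength_le_triangle hm

/-- **The downward staircase on `E2`-type states, pair-free**: order exactly `q ≥ 2`, `ē ≤ 2`, and
`jetColength q k F = k(k+1)/2` give `jetColength q k' F = k'(k'+1)/2` for all `k' ≤ k` — idea-3's order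
letter `o(F) := max {k : d_k = k(k+1)/2}` is well defined on every state of an `E2` chain (CARD I-3-11
§1). OURS (glue). [cite: AtiyahMacdonald1969, Prop. 6.9 (length is additive)] -/
theorem jetColength_eq_triangle_downward_of_finrank_le_two {q : ℕ} (hq : 2 ≤ q)
    {F : MvPolynomial (Fin 4) K} (hord : ordZero F = q)
    (he : Module.finrank K (additiveSubspace (initialForm F)) ≤ 2) {k k' : ℕ}
    (hk : jetColength q k F = k * (k + 1) / 2) (hk' : k' ≤ k) :
    jetColength q k' F = k' * (k' + 1) / 2 := by
  obtain ⟨a, b, hab, hm⟩ := exists_originIdeal_le_span_pair_sup hq hord he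
  exact jetColength_eq_triangle_downward hab hm hk hk'

/-- `jetColength` is non-decreasing in the level. OURS (bookkeeping). [cite: AtiyahMacdonald1969, Prop. 6.9 (length is additive)] -/
theorem jetColength_mono (q : ℕ) (F : MvPolynomial (Fin 4) K) {k N : ℕ} (h : k ≤ N) :
    jetColength q k F ≤ jetColength q N F := by
  obtain ⟨d, rfl⟩ := Nat.exists_eq_add_of_le h
  clear h
  induction d with
  | zero => exact le_rfl
  | succ d ih => exact ih.trans (by rw [← add_assoc]; exact jetColength_le_succ q (k + d) F)

/-- **The order set is bounded at isolated states**: at a certificate level `N`, every `k` with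
`jetColength q k F = k(k+1)/2` has `k(k+1)/2 ≤ μ⁺ = jetColength q N F` (the colength sequence is
non-decreasing and constant from `N` on), so `o(F) := max {k : d_k = k(k+1)/2}` exists. OURS
(bookkeeping). [cite: AtiyahMacdonald1969, Prop. 6.9 (length is additive)] -/
theorem triangle_le_jetColength_of_isCert {q N k : ℕ} {F : MvPolynomial (Fin 4) K} (hN : IsCert q N F)
    (hk : jetColength q k F = k * (k + 1) / 2) : k * (k + 1) / 2 ≤ jetColength q N F := by
  rw [← hk]
  rcases le_total k N with h | h
  · exact jetColength_mono q F h
  · rw [jetColength_eq_of_isCert hN h]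

end Summit.ResolutionOfSingularities.ResolutionOfSingularities.Theorems.PIDim4.RidgeBudget

end
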